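import Summits.QuantumAdvantage.AdviceFreeQNC0.CombGateJ37Count
import HarnessLib

/-!
# Cell qa-qnc0 — THE COMB THEOREM for an arbitrary 3-separated candidate set of POLYLOG size (3/3)
# (planner qa-qnc0-p1 gen 36, ROUND-35 §4.10 (7)(α); generalises `CombGate37.lean`, same proof)

Cell qa-qnc0, crux stmt-QuantumAdvantage-22907 (route DWalkThree).  AUTHORED AND PROVED BY THE PLANNER qa-qnc0-p1 gen 36 (ROUND-35 §4.10 (7)(8′), INBOX 14:05Z/14:12Z, evidence #53 on stmt-22907, file `HOME/qa-qnc0-p1/exp36/CombGateJ37.lean` v3, 840 lines, rc 0 / 0 sorries); landed verbatim by qn-prover-3 g21 as a mechanical three-way split (≤ 400 lines each): `CombGateJ37Fibre` (flips, candidates, Steps 2a–2c) → `CombGateJ37Count` (Steps 1, 3) → `CombGateJ37` (Steps 4–7: `comb_leJ`, `gateSum_flipAt`, `gateGated_leJ`, `exists_isComb_sub`, `denseGate_le`, `three_window`).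

`IsComb J`: positions `1 ≤ j`, `j + 1 < n`, pairwise distance `≥ 3`.  `comb_leJ`: ∃ θ < 1 ∀ C ∃ A n₀ ∀ n ≥ n₀ ∀ J, IsComb J →
A·(log₂ n)^{2C+1} ≤ |J| → window-local branches (window `(log₂ n)^C`) gated by any selector blind to the admissible isolated flips at
the positions of `J` win on at most `θ·2ⁿ` inputs.  (The residue class `j ≡ 1 (3)` of `CombGate37.comb_le` is one such `J` of size ⌊n/3⌋;
here POLYLOG many blind spots suffice.)

Step 5 — ONE ARBITRARY DENSE GATE: `gateSum ℓ u = Σ_i [x_i(u)]·ℓ_i`; `gateSum_flipAt` (GATE BLINDNESS: the admissible isolated flip at `j` fixes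
`Σ ℓ_i x_i` when the neighbours of `j` differ and `ℓ_j = ℓ_{j+1}` — it swaps `x_j, x_{j+1}` — or agree and `ℓ_j + ℓ_{j+1} = 0` — it toggles both);
`gateGated_leJ`: (G₁) for every gate `ℓ` and every 3-separated `J` inside its equal/opposite-type positions, selection by ANY `f (Σ ℓ_i x_i)`.
Step 6 — FROM A COUNT: `exists_isComb_sub` (every position set has a 3-separated subset of a third of its size), `goodPairs ℓ`,
`denseGate_le`: ∃ θ < 1 ∀ C ∃ A n₀ ∀ n ≥ n₀ ∀ ℓ, A·(log₂ n)^{2C+1} ≤ #goodPairs ℓ → window-local branches selected by any `f (Σ ℓ_i x_i)` win on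
≤ θ·2ⁿ inputs.  Constant, alternating-sign, periodic and generic coefficient words all have linearly many good pairs; the only words escaping are
of MIXED type (one of `ℓ_j, ℓ_{j+1}` zero) at all but polylog many 3-separated positions, e.g. `1,0,1,0,…` — those need interval flips (ROUND-35 §4.10 (8)).
-/

noncomputable section

open Classical

namespace Summit.QuantumAdvantage.AdviceFreeQNC0

open Finset
open Literature.Computability.MetaComplexity Literature.Computability.MetaComplexity.Smolensky
open AffBells22 Subcube

namespace Comb37J

variable {n : ℕ}
variable {J : Finset (Fin n)}

/-! ### Step 4: THE COMB THEOREM (polylog blind spots) -/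

/-- **THE COMB THEOREM, polylog form.**  Some `θ < 1`; for every `C` some `A, n₀`; for `n ≥ n₀` and every 3-separated candidate set
`J` with `|J| ≥ A·(log₂ n)^{2C+1}`: window-local branches (window `(log₂ n)^C`) gated by ANY selector (any codomain) that is blind to
the admissible isolated flips at the positions of `J` win on at most `θ·2ⁿ` inputs. -/
theorem comb_leJ : ∃ θ : ℝ, θ < 1 ∧ ∀ C : ℕ, ∃ A n₀ : ℕ, ∀ n ≥ n₀, ∀ (J : Finset (Fin n)), IsComb J →
    A * (Nat.log 2 n) ^ (2 * C + 1) ≤ J.card → ∀ (c : ℕ) (T : Type) (σ : (Fin n → Bool) → T) (rel : Fin n → Bool)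
    (G : T → Fin (n + 1) → (Fin n → Bool) → Bool),
    (∀ (u : Fin n → Bool) (j : Fin n), j ∈ J → nbEq u j = rel j → σ (flipAt u j) = σ u) →
    (∀ t, WindowLocal ((Nat.log 2 n) ^ C) (G t)) →
    ((univ.filter fun u : Fin n → Bool => ringWinU c (fun g u => G (σ u) g u) u = true).card : ℝ)
      ≤ θ * (2 : ℝ) ^ n := by
  obtain ⟨c₀, hc₀, m₀, hcore⟩ := failSet_ge_of_mem_fullSpan
  refine ⟨1 - c₀ / 2, by linarith, fun C => ⟨3 * (m₀ + 16) + 1, 2, fun n hn J hJ hA c T σ rel G hσ hloc => ?_⟩⟩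
  have hn2 : 2 ≤ n := hn
  set L := Nat.log 2 n with hL
  set t := m₀ + 16 * L ^ (2 * C) with ht
  set K := J.card with hK
  have hL1 : 1 ≤ L := Nat.le_log_of_pow_le (by norm_num) (by simpa using hn2)
  have hKn : K ≤ n := by
    calc K ≤ (univ : Finset (Fin n)).card := card_le_univ _
      _ = n := by rw [card_univ, Fintype.card_fin]
  have hnL : n < 2 ^ (L + 1) := Nat.lt_pow_succ_log_self (by norm_num) n
  -- room
  have hroom : (L + 2) * t + 1 ≤ K := by
    have hL2C : 1 ≤ L ^ (2 * C) := Nat.one_le_pow _ _ hL1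
    have hL2C1 : 1 ≤ L ^ (2 * C + 1) := Nat.one_le_pow _ _ hL1
    have a1 : m₀ ≤ m₀ * L ^ (2 * C) := Nat.le_mul_of_pos_right _ hL2C
    have a2 : t ≤ (m₀ + 16) * L ^ (2 * C) := by rw [ht, add_mul]; omega
    have a3 : (L + 2) * t ≤ 3 * L * ((m₀ + 16) * L ^ (2 * C)) :=
      le_trans (Nat.mul_le_mul_right _ (by omega)) (Nat.mul_le_mul_left _ a2)
    have a4 : 3 * L * ((m₀ + 16) * L ^ (2 * C)) = (3 * (m₀ + 16)) * L ^ (2 * C + 1) := by ring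
    have a5 : (3 * (m₀ + 16) + 1) * L ^ (2 * C + 1) = (3 * (m₀ + 16)) * L ^ (2 * C + 1) + L ^ (2 * C + 1) := by ring
    have a6 := le_trans a3 (le_of_eq a4)
    rw [a5] at hA
    generalize (3 * (m₀ + 16)) * L ^ (2 * C + 1) = Y at a6 hA
    omega
  have htK : t ≤ K := by nlinarith
  -- the fibre terms
  set Q : (Fin n → Bool) → Prop := fun u => ringWinU c (fun g u => G (σ u) g u) u = true with hQ
  set F : (Fin n → Bool) → ℝ := fun a =>
    ((univ.filter fun u : Fin n → Bool => (∀ i ∈ Wset J rel a, u i = a i) ∧ Q u).card : ℝ) /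
      (2 : ℝ) ^ (Good J rel a).card with hF
  have hF1 : ∀ a, F a ≤ 1 := by
    intro a
    rw [hF]
    simp only
    rw [div_le_one (by positivity)]
    have h : (univ.filter fun u : Fin n → Bool => (∀ i ∈ Wset J rel a, u i = a i) ∧ Q u).card ≤
        (univ.filter fun u : Fin n → Bool => ∀ i ∈ Wset J rel a, u i = a i).card :=
      card_le_card (fun u hu => by rw [mem_filter] at hu ⊢; exact ⟨hu.1, hu.2.1⟩)
    rw [card_agree, card_Wset] at h
    exact_mod_cast h
  have hFg : ∀ a, ¬ (Good J rel a).card ≤ t → F a ≤ 1 - c₀ := by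
    intro a ha
    rw [not_le] at ha
    have hm : m₀ ≤ (Good J rel a).card := by omega
    have hr : 16 * (L ^ C) ^ 2 ≤ (Good J rel a).card := by
      rw [← pow_mul, mul_comm C 2]; omega
    have h := fibre_le hcore hJ σ rel (L ^ C) G hσ hloc c a hm hr
    rw [hF]
    simp only
    rw [div_le_iff₀ (by positivity)]
    exact h
  -- bad backgrounds
  set bad := univ.filter fun a : Fin n → Bool => (Good J rel a).card ≤ t with hbad
  set good := univ.filter fun a : Fin n → Bool => ¬ (Good J rel a).card ≤ t with hgood
  have hbadN : bad.card ≤ 2 ^ (n - 1) :=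
    le_trans (card_fewGood_le hJ rel htK) (choose_mul_pow_le hKn hnL hroom)
  have hbadR : (bad.card : ℝ) ≤ (2 : ℝ) ^ n / 2 := by
    have h : (bad.card : ℝ) ≤ (2 : ℝ) ^ (n - 1) := by exact_mod_cast hbadN
    have e : (2 : ℝ) ^ n = 2 * (2 : ℝ) ^ (n - 1) := by
      rw [← pow_succ']; congr 1; omega
    rw [e]; linarith
  have hcards : (bad.card : ℝ) + good.card = (2 : ℝ) ^ n := by
    have h := card_filter_add_card_filter_not (s := (univ : Finset (Fin n → Bool)))
      (fun a : Fin n → Bool => (Good J rel a).card ≤ t)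
    rw [card_univ, Fintype.card_fun, Fintype.card_bool, Fintype.card_fin] at h
    rw [hbad, hgood]
    exact_mod_cast h
  -- the sum
  rw [card_eq_sum_fibres hJ rel Q]
  have hsplit : ∑ a : Fin n → Bool, F a = ∑ a ∈ bad, F a + ∑ a ∈ good, F a := by
    rw [hbad, hgood]; exact (sum_filter_add_sum_filter_not _ _ _).symm
  have hb : ∑ a ∈ bad, F a ≤ bad.card * 1 := by
    have := Finset.sum_le_card_nsmul bad F 1 (fun a _ => hF1 a)
    rwa [nsmul_eq_mul] at this
  have hg : ∑ a ∈ good, F a ≤ good.card * (1 - c₀) := by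
    have := Finset.sum_le_card_nsmul good F (1 - c₀) (fun a ha => hFg a (by rw [hgood, mem_filter] at ha; exact ha.2))
    rwa [nsmul_eq_mul] at this
  have hc' : c₀ * (bad.card : ℝ) ≤ c₀ * ((2 : ℝ) ^ n / 2) := mul_le_mul_of_nonneg_left hbadR hc₀.le
  have hgc : (good.card : ℝ) * (1 - c₀) = ((2 : ℝ) ^ n - bad.card) * (1 - c₀) := by rw [← hcards]; ring
  show ∑ a : Fin n → Bool, F a ≤ (1 - c₀ / 2) * (2 : ℝ) ^ n
  rw [hsplit]
  nlinarith [hb, hg, hc', hgc]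

/-! ### Step 5: one arbitrary dense gate `ℓ·x` — blind spots at equal-type and opposite-type positions -/

/-- the value of the gate `Σ_i ℓ_i x_i` on the input `x = x(u)`. -/
def gateSum (ℓ : Fin (n + 1) → ZMod 3) (u : Fin n → Bool) : ZMod 3 := ∑ i : Fin (n + 1), if xOfU u i = true then ℓ i else 0

/-- The extended input is unchanged by `flipAt u j` away from position `j`. -/
theorem uExt_flipAt_of_ne (u : Fin n → Bool) (j : Fin n) {k : ℕ} (hk : k ≠ j.val) :
    uExt (flipAt u j) k = uExt u k := by
  unfold uExt
  by_cases hkn : k < n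
  · rw [dif_pos hkn, dif_pos hkn]
    exact flipAt_ne u (fun h => hk (by rw [← h]))
  · rw [dif_neg hkn, dif_neg hkn]

/-- `flipAt u j` negates the extended input at position `j`. -/
theorem uExt_flipAt_self (u : Fin n → Bool) (j : Fin n) : uExt (flipAt u j) j.val = !uExt u j.val := by
  unfold uExt
  rw [dif_pos j.isLt, dif_pos j.isLt]
  have : (⟨j.val, j.isLt⟩ : Fin n) = j := Fin.ext rfl
  rw [this, flipAt_self]

/-- A walk bit `x_i` with `i ∉ {j, j+1}` is unchanged by `flipAt u j` (`1 ≤ j`). -/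
theorem xOfU_flipAt_of_ne (u : Fin n → Bool) (j : Fin n) {i : Fin (n + 1)} (h1 : i.val ≠ j.val)
    (h2 : i.val ≠ j.val + 1) (hj1 : 1 ≤ j.val) : xOfU (flipAt u j) i = xOfU u i := by
  unfold xOfU
  rw [uExt_flipAt_of_ne u j h1]
  by_cases hi0 : i.val = 0
  · rw [if_pos hi0, if_pos hi0]
  · rw [if_neg hi0, if_neg hi0, uExt_flipAt_of_ne u j (by omega)]

/-- the two-term bookkeeping behind gate blindness. -/
theorem pair_swap_sum (p q r : Bool) (la lb S : ZMod 3)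
    (h : ((p == r) = false ∧ la = lb) ∨ ((p == r) = true ∧ la + lb = 0)) :
    (if (!xor (!q) p) = true then la else 0) + ((if (!xor r (!q)) = true then lb else 0) + S)
      = (if (!xor q p) = true then la else 0) + ((if (!xor r q) = true then lb else 0) + S) := by
  rcases h with ⟨h1, h2⟩ | ⟨h1, h2⟩
  · subst h2
    revert h1
    cases p <;> cases q <;> cases r <;> simp
  · have h3 : lb = -la := eq_neg_of_add_eq_zero_right h2
    subst h3
    revert h1
    cases p <;> cases q <;> cases r <;> simp

/-- **Gate blindness.**  The isolated flip at `j` does not change `Σ ℓ_i x_i` if EITHER the neighbours of `j` differ and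
`ℓ_j = ℓ_{j+1}` (the flip swaps `x_j, x_{j+1}`), OR the neighbours agree and `ℓ_j + ℓ_{j+1} = 0` (the flip toggles both). -/
theorem gateSum_flipAt (hJ : IsComb J) (ℓ : Fin (n + 1) → ZMod 3) {u : Fin n → Bool} {j : Fin n} (hj : j ∈ J)
    (hrel : (nbEq u j = false ∧ ℓ ⟨j.val, by omega⟩ = ℓ ⟨j.val + 1, by have := hJ.succ_lt j hj; omega⟩) ∨
      (nbEq u j = true ∧ ℓ ⟨j.val, by omega⟩ + ℓ ⟨j.val + 1, by have := hJ.succ_lt j hj; omega⟩ = 0)) :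
    gateSum ℓ (flipAt u j) = gateSum ℓ u := by
  have hj1 := hJ.one_le j hj
  have hj2 := hJ.succ_lt j hj
  set a : Fin (n + 1) := ⟨j.val, by omega⟩ with ha
  set b : Fin (n + 1) := ⟨j.val + 1, by omega⟩ with hb
  have hab : a ≠ b := by
    intro h; have := congrArg Fin.val h; rw [ha, hb] at this; simp at this
  have hbmem : b ∈ (univ : Finset (Fin (n + 1))).erase a := mem_erase.2 ⟨hab.symm, mem_univ _⟩
  have key : ∀ v : Fin n → Bool, gateSum ℓ v = (if xOfU v a = true then ℓ a else 0) +
      ((if xOfU v b = true then ℓ b else 0) +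
        ∑ i ∈ ((univ : Finset (Fin (n + 1))).erase a).erase b, if xOfU v i = true then ℓ i else 0) := by
    intro v
    unfold gateSum
    rw [← Finset.add_sum_erase _ _ (mem_univ a), ← Finset.add_sum_erase _ _ hbmem]
  rw [key, key]
  have hrest : ∑ i ∈ ((univ : Finset (Fin (n + 1))).erase a).erase b, (if xOfU (flipAt u j) i = true then ℓ i else 0)
      = ∑ i ∈ ((univ : Finset (Fin (n + 1))).erase a).erase b, (if xOfU u i = true then ℓ i else 0) := by
    refine sum_congr rfl fun i hi => ?_
    have hib : i ≠ b := (mem_erase.1 hi).1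
    have hia : i ≠ a := (mem_erase.1 (mem_erase.1 hi).2).1
    have h1 : i.val ≠ j.val := fun h => hia (Fin.ext (by rw [ha]; exact h))
    have h2 : i.val ≠ j.val + 1 := fun h => hib (Fin.ext (by rw [hb]; exact h))
    rw [xOfU_flipAt_of_ne u j h1 h2 hj1]
  rw [hrest]
  have hxa : ∀ v : Fin n → Bool, xOfU v a = !(xor (uExt v j.val) (uExt v (j.val - 1))) := by
    intro v; unfold xOfU; rw [ha]; simp only; rw [if_neg (by omega)]
  have hxb : ∀ v : Fin n → Bool, xOfU v b = !(xor (uExt v (j.val + 1)) (uExt v j.val)) := by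
    intro v; unfold xOfU; rw [hb]; simp only; rw [if_neg (by omega), Nat.add_sub_cancel]
  rw [hxa, hxb, hxa, hxb, uExt_flipAt_self, uExt_flipAt_of_ne u j (show j.val - 1 ≠ j.val by omega),
    uExt_flipAt_of_ne u j (show j.val + 1 ≠ j.val by omega)]
  unfold nbEq at hrel
  generalize ℓ a = la at hrel ⊢
  generalize ℓ b = lb at hrel ⊢
  generalize uExt u (j.val - 1) = p at hrel ⊢
  generalize uExt u j.val = q
  generalize uExt u (j.val + 1) = r at hrel ⊢
  exact pair_swap_sum p q r la lb _ hrel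

/-- the relation table of a gate: at equal-type positions use unequal-neighbour flips, otherwise equal-neighbour flips. -/
def relOf (ℓ : Fin (n + 1) → ZMod 3) (j : Fin n) : Bool :=
  !decide (ℓ ⟨j.val, by omega⟩ = ℓ ⟨j.val + 1, by omega⟩)

/-- **(G₁) FOR ONE ARBITRARY DENSE GATE with polylog many non-mixed positions.**  Some `θ < 1`; for every `C` some `A, n₀`; for
`n ≥ n₀`, every gate `ℓ`, and every 3-separated set `J` of positions of EQUAL (`ℓ_j = ℓ_{j+1}`) or OPPOSITE (`ℓ_j + ℓ_{j+1} = 0`) type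
with `|J| ≥ A·(log₂ n)^{2C+1}`: window-local branches selected by ANY function (any codomain) of the gate value `Σ ℓ_i x_i` win on at
most `θ·2ⁿ` inputs.  (Every gate whose coefficient sequence has `≫ (log n)^{2C+1}` adjacent equal or opposite pairs — e.g. constant,
alternating `1,2,1,2,…`, periodic with runs, or random — qualifies; only gates of MIXED type almost everywhere, like `1,0,1,0,…`, escape.) -/
theorem gateGated_leJ : ∃ θ : ℝ, θ < 1 ∧ ∀ C : ℕ, ∃ A n₀ : ℕ, ∀ n ≥ n₀, ∀ (ℓ : Fin (n + 1) → ZMod 3) (J : Finset (Fin n)),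
    IsComb J → (∀ j ∈ J, ℓ ⟨j.val, by omega⟩ = ℓ ⟨j.val + 1, by omega⟩ ∨ ℓ ⟨j.val, by omega⟩ + ℓ ⟨j.val + 1, by omega⟩ = 0) →
    A * (Nat.log 2 n) ^ (2 * C + 1) ≤ J.card → ∀ (c : ℕ) (T : Type) (f : ZMod 3 → T)
    (G : T → Fin (n + 1) → (Fin n → Bool) → Bool), (∀ t, WindowLocal ((Nat.log 2 n) ^ C) (G t)) →
    ((univ.filter fun u : Fin n → Bool => ringWinU c (fun g u => G (f (gateSum ℓ u)) g u) u = true).card : ℝ)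
      ≤ θ * (2 : ℝ) ^ n := by
  obtain ⟨θ, hθ, h⟩ := comb_leJ
  refine ⟨θ, hθ, fun C => ?_⟩
  obtain ⟨A, n₀, hn₀⟩ := h C
  refine ⟨A, n₀, fun n hn ℓ J hJ htype hA c T f G hloc => ?_⟩
  refine hn₀ n hn J hJ hA c T (fun u => f (gateSum ℓ u)) (relOf ℓ) G (fun u j hj hnb => ?_) hloc
  show f (gateSum ℓ (flipAt u j)) = f (gateSum ℓ u)
  rw [gateSum_flipAt hJ ℓ hj ?_]
  unfold relOf at hnb
  rcases htype j hj with he | ho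
  · left
    refine ⟨?_, he⟩
    rw [hnb]
    simp [he]
  · by_cases he : ℓ ⟨j.val, by omega⟩ = ℓ ⟨j.val + 1, by omega⟩
    · left
      refine ⟨?_, he⟩
      rw [hnb]
      simp [he]
    · right
      refine ⟨?_, ho⟩
      rw [hnb]
      simp [he]

/-! ### Step 6: thinning — a 3-separated third of any position set; (G₁) from a pure COUNT of equal/opposite adjacent pairs -/

/-- An order embedding `Fin k ↪o Fin n` stretches gaps: `e i + d ≤ e i'` whenever `i + d = i'`. -/
theorem gap_le {k : ℕ} (e : Fin k ↪o Fin n) :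
    ∀ (d : ℕ) (i i' : Fin k), i.val + d = i'.val → (e i).val + d ≤ (e i').val := by
  intro d
  induction d with
  | zero =>
    intro i i' h
    have : i = i' := Fin.ext (by omega)
    subst this; simp
  | succ d ih =>
    intro i i' h
    have hlt : i.val + d < k := by omega
    have h1 := ih i ⟨i.val + d, hlt⟩ rfl
    have h2 : e ⟨i.val + d, hlt⟩ < e i' := e.strictMono (Fin.mk_lt_of_lt_val (by omega))
    have h2' : (e ⟨i.val + d, hlt⟩).val < (e i').val := h2
    omega

/-- every set of positions contains a 3-separated subset of at least a third of its size. -/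
theorem exists_isComb_sub (S : Finset (Fin n)) (hS : ∀ j ∈ S, 1 ≤ j.val ∧ j.val + 1 < n) :
    ∃ J : Finset (Fin n), J ⊆ S ∧ IsComb J ∧ S.card ≤ 3 * J.card := by
  set k := S.card with hk
  set e : Fin k ↪o Fin n := S.orderEmbOfFin hk.symm with he
  set I : Finset (Fin k) := univ.filter fun i : Fin k => i.val % 3 = 0 with hI
  refine ⟨I.map e.toEmbedding, ?_, ?_, ?_⟩
  · intro j hj
    rw [mem_map] at hj
    obtain ⟨i, -, rfl⟩ := hj
    exact S.orderEmbOfFin_mem hk.symm i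
  · refine ⟨fun j hj => ?_, fun j hj => ?_, fun j hj j' hj' hlt => ?_⟩
    · rw [mem_map] at hj
      obtain ⟨i, -, rfl⟩ := hj
      exact (hS _ (S.orderEmbOfFin_mem hk.symm i)).1
    · rw [mem_map] at hj
      obtain ⟨i, -, rfl⟩ := hj
      exact (hS _ (S.orderEmbOfFin_mem hk.symm i)).2
    · rw [mem_map] at hj hj'
      obtain ⟨i, hi, rfl⟩ := hj
      obtain ⟨i', hi', rfl⟩ := hj'
      rw [hI, mem_filter] at hi hi'
      have hii' : i < i' := by
        by_contra hle
        rw [not_lt] at hle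
        have := e.monotone hle
        exact absurd hlt (not_lt.2 (by exact_mod_cast this))
      have hi3 : i.val + 3 ≤ i'.val := by have := Fin.lt_def.1 hii'; omega
      have hlt3 : i.val + 3 ≤ k := by omega
      have h1 := gap_le e 3 i ⟨i.val + 3, by omega⟩ rfl
      have h2 : (e ⟨i.val + 3, by omega⟩).val ≤ (e i').val := by
        have := e.monotone (show (⟨i.val + 3, by omega⟩ : Fin k) ≤ i' from Fin.mk_le_of_le_val hi3)
        exact_mod_cast this
      show (e.toEmbedding i).val + 3 ≤ (e.toEmbedding i').val
      have : ∀ x, (e.toEmbedding x) = e x := fun x => rfl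
      rw [this, this]
      omega
  · rw [card_map]
    -- `k ≤ 3 · #{i < k : 3 ∣ i}` via the injection `i ↦ 3i` on `Fin ((k+2)/3)`
    set f : Fin ((k + 2) / 3) → Fin k := fun i => ⟨3 * i.val, by have := i.isLt; omega⟩ with hf
    have hinj : Function.Injective f := by
      intro a b h
      have := congrArg Fin.val h
      rw [hf] at this
      simp only at this
      exact Fin.ext (by omega)
    have himg : (univ.image f) ⊆ I := by
      intro i hi
      rw [mem_image] at hi
      obtain ⟨a, -, rfl⟩ := hi
      rw [hI, mem_filter, hf]
      simp
    have hc : (k + 2) / 3 ≤ I.card :=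
      calc (k + 2) / 3 = (univ.image f).card := by rw [card_image_of_injective _ hinj, card_univ, Fintype.card_fin]
        _ ≤ I.card := card_le_card himg
    omega

/-- the set of GOOD ADJACENT PAIRS of a coefficient word: positions `1 ≤ j`, `j+1 < n` with `ℓ_j = ℓ_{j+1}` or `ℓ_j + ℓ_{j+1} = 0`. -/
def goodPairs (ℓ : Fin (n + 1) → ZMod 3) : Finset (Fin n) :=
  univ.filter fun j : Fin n => 1 ≤ j.val ∧ j.val + 1 < n ∧
    (ℓ ⟨j.val, by omega⟩ = ℓ ⟨j.val + 1, by omega⟩ ∨ ℓ ⟨j.val, by omega⟩ + ℓ ⟨j.val + 1, by omega⟩ = 0)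

/-- **(G₁) FROM A COUNT.**  Some `θ < 1`; for every `C` some `A, n₀`; for `n ≥ n₀` and every gate `ℓ` whose coefficient word has at
least `A·(log₂ n)^{2C+1}` good adjacent pairs (equal or opposite nonzero/zero-zero neighbours), window-local branches selected by ANY
function of `Σ ℓ_i x_i` win on at most `θ·2ⁿ` inputs. -/
theorem denseGate_le : ∃ θ : ℝ, θ < 1 ∧ ∀ C : ℕ, ∃ A n₀ : ℕ, ∀ n ≥ n₀, ∀ (ℓ : Fin (n + 1) → ZMod 3),
    A * (Nat.log 2 n) ^ (2 * C + 1) ≤ (goodPairs ℓ).card → ∀ (c : ℕ) (T : Type) (f : ZMod 3 → T)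
    (G : T → Fin (n + 1) → (Fin n → Bool) → Bool), (∀ t, WindowLocal ((Nat.log 2 n) ^ C) (G t)) →
    ((univ.filter fun u : Fin n → Bool => ringWinU c (fun g u => G (f (gateSum ℓ u)) g u) u = true).card : ℝ)
      ≤ θ * (2 : ℝ) ^ n := by
  obtain ⟨θ, hθ, h⟩ := gateGated_leJ
  refine ⟨θ, hθ, fun C => ?_⟩
  obtain ⟨A, n₀, hn₀⟩ := h C
  refine ⟨3 * A, n₀, fun n hn ℓ hA c T f G hloc => ?_⟩
  have hS : ∀ j ∈ goodPairs ℓ, 1 ≤ j.val ∧ j.val + 1 < n := by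
    intro j hj; unfold goodPairs at hj; rw [mem_filter] at hj; exact ⟨hj.2.1, hj.2.2.1⟩
  obtain ⟨J, hJS, hJ, hcard⟩ := exists_isComb_sub (goodPairs ℓ) hS
  refine hn₀ n hn ℓ J hJ (fun j hj => ?_) ?_ c T f G hloc
  · have := hJS hj
    unfold goodPairs at this; rw [mem_filter] at this
    exact this.2.2.2
  · have : 3 * A * (Nat.log 2 n) ^ (2 * C + 1) = 3 * (A * (Nat.log 2 n) ^ (2 * C + 1)) := by ring
    rw [this] at hA
    omega

/-! ### Step 7 (statement-level pointers for interval flips, ROUND-35 §4.10 (9)) -/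

/-- **Three-window lemma.**  Among any three coefficients two are equal or opposite (the classes of `𝔽₃` under `±` are `{0}` and
`{1,2}`): every word `ℓ` has a good pair at distance `≤ 2` in every window of three consecutive positions, so blocks of length `≤ 2`
give EVERY single gate linearly many blind spots. -/
theorem three_window (a b c : ZMod 3) :
    (a = b ∨ a + b = 0) ∨ (b = c ∨ b + c = 0) ∨ (a = c ∨ a + c = 0) := by
  revert a b c; decide

end Comb37J

end Summit.QuantumAdvantage.AdviceFreeQNC0
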